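import Literature.NumberTheory.GaloisRepresentations.CliffordInducedPrimeIndex
import HarnessLib

/-!
# Clifford's theorem in prime index: explicit conjugacy to the induced representation

Topic `NumberTheory/GaloisRepresentations`; namespace
`Literature.NumberTheory.GaloisRepresentations`.  Theorems only: **no definition and no named
fact is introduced**.

The companion file `CliffordInducedPrimeIndex` proves Clifford's theorem for a normal subgroup of
PRIME index at the level of characteristic polynomials.  Here the same adapted basis
`B (i, a) = r(tᵢ) u_a` of `V = ⊕ᵢ r(tᵢ) V_{λ₀}` (now built directly on the PRESCRIBED transversal
`t` of `G / N`, not on the powers of a generator) is turned into an explicit change of frame: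

* `Matrix.exists_units_conj_eq_reindex_toMatrix` — for a basis `B` of `Aⁿ` indexed by `κ` and a
  relabelling `e : κ ≃ Fin n` there is `Q ∈ GL_n(A)` with `Q [f] Q⁻¹ = reindex e e [f]_B` for every
  endomorphism `f` (change of basis, Mathlib `Module.Basis.toMatrix`);
* `FramedRep.exists_conj_eq_reindex_comp_indMatrix_of_conj_eq_twist` — **twist form ⟹ induced
  form, explicit conjugacy.**  `r : G →ₜ* GL_n(A)` irreducible over `A` algebraically closed,
  `φ : H →ₜ* G` injective with image `N` of prime index `p`, `P r P⁻¹ = r ⊗ χ` for a character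
  `χ ≠ 1` trivial on `N`, and `t` ANY transversal of `G / N`: there are an irreducible framed
  `s : H →ₜ* GL_m(A)`, `Q ∈ GL_n(A)` and `e : ι × Fin m ≃ Fin n` with
  `Q r(x) Q⁻¹ = reindex e e (Ind(s)(x))` for all `x ∈ G` (`indMatrix`, flattened by `Matrix.comp`);
* `exists_conj_eq_reindex_induce_of_not_isIrreducible_restrictField_of_prime` — **Galois form.**
  For `L/K` Galois of prime degree and `r : Γ_K → GL_n(A)` irreducible with `r|_{Γ_L}` reducible
  (`A` algebraically closed of characteristic zero): `Q r Q⁻¹ = reindex e e (Ind_{Γ_L}^{Γ_K} s)`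
  for an irreducible `s : Γ_L → GL_m(A)`, with the tree's `FramedGaloisRep.induce`.

Proof of the framed form: as in `CliffordInducedPrimeIndex`, `r(g)` maps the eigenspace `V_λ` of
`P` to `V_{χ(g) λ}`; since `N ≤ ker χ` both have index `p` one has `N = ker χ`, so `i ↦ χ(tᵢ)` is
injective and the translates `r(tᵢ) U` of the `N`-stable `U = V_{λ₀}` lie in DISTINCT eigenspaces;
`∑ᵢ r(tᵢ) U` is `G`-stable and non-zero, hence `V = ⊕ᵢ r(tᵢ) U`; in the adapted basis the matrix of
`r(x)` is `Ind(s)(x)` (`Representation.toMatrix_eq_comp_indMatrix`), and conjugating by the change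
of basis from the standard frame gives the claim.  Irreducibility of `s` uses
`Representation.isIrreducible_toRepresentation_of_iSupIndep` with the transversal modified at the
trivial coset (`t i₁ ↦ 1`).

## Not here

Non-prime index (general Clifford correspondence); uniqueness of `s` up to `Gal`-conjugacy.

## References

* A. H. Clifford, *Representations induced in an invariant subgroup*, Ann. of Math. (2) 38
  (1937), 533–550, §§1–3, Thm. 1. [Clifford1937]
* J.-P. Serre, *Linear representations of finite groups*, GTM 42 (1977), §3.3 Thm. 12 (proof),
  §7.3 Prop. 22, §8.1 Prop. 24. [SerreLinearRepresentations1977]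
-/

noncomputable section

open scoped MatrixGroups

namespace Literature.NumberTheory.GaloisRepresentations

universe u u' v

/-! ### Change of basis to a reindexed basis of `Aⁿ` -/

section ChangeOfBasis

/-- **Change of frame.**  For a basis `B` of `Aⁿ = Fin n → A` indexed by `κ` and a relabelling
`e : κ ≃ Fin n`, there is `Q ∈ GL_n(A)` (the inverse of the matrix of the vectors `B (e⁻¹ j)` in
the standard basis) such that `Q [f] Q⁻¹ = reindex e e [f]_B` for every endomorphism `f`, `[f]` the
standard matrix (Mathlib `basis_toMatrix_mul_linearMap_toMatrix_mul_basis_toMatrix`,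
`Module.Basis.toMatrix_mul_toMatrix_flip`). [folklore] -/
theorem Matrix.exists_units_conj_eq_reindex_toMatrix {A : Type*} [CommRing A] {n : ℕ}
    {κ : Type*} [Fintype κ] [DecidableEq κ] (B : Module.Basis κ A (Fin n → A)) (e : κ ≃ Fin n) :
    ∃ Q : GL (Fin n) A, ∀ f : Module.End A (Fin n → A),
      (Q : Matrix (Fin n) (Fin n) A) * LinearMap.toMatrix' f *
          ((Q⁻¹ : GL (Fin n) A) : Matrix (Fin n) (Fin n) A) =
        Matrix.reindex e e (LinearMap.toMatrix B B f) := by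
  let B' : Module.Basis (Fin n) A (Fin n → A) := B.reindex e
  let std : Module.Basis (Fin n) A (Fin n → A) := Pi.basisFun A (Fin n)
  refine ⟨⟨B'.toMatrix std, std.toMatrix B', B'.toMatrix_mul_toMatrix_flip std,
    std.toMatrix_mul_toMatrix_flip B'⟩, fun f => ?_⟩
  have h1 : LinearMap.toMatrix B' B' f = Matrix.reindex e e (LinearMap.toMatrix B B f) := by
    ext i j
    simp only [B', LinearMap.toMatrix_apply, Module.Basis.reindex_apply,
      Module.Basis.repr_reindex_apply, Matrix.reindex_apply, Matrix.submatrix_apply]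
  rw [← h1, ← basis_toMatrix_mul_linearMap_toMatrix_mul_basis_toMatrix B' std B' std f]
  rfl

end ChangeOfBasis

/-! ### Framed representations: twist-stable of prime index ⟹ conjugate to the induced matrix -/

section Framed

variable {G : Type u} {H : Type u'} [Group G] [TopologicalSpace G] [Group H] [TopologicalSpace H]
  [IsTopologicalGroup H] {A : Type v} [Field A] [TopologicalSpace A] [IsTopologicalRing A] {n : ℕ}

/-- **Clifford's theorem in prime index, twist form ⟹ induced form (explicit conjugacy).**  Let
`r : G →ₜ* GL_n(A)` be an irreducible framed representation over an algebraically closed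
topological field `A`, `φ : H →ₜ* G` injective with image `N` of PRIME index `p`,
`P r P⁻¹ = r ⊗ χ` for some `P ∈ GL_n(A)` and a continuous character `χ ≠ 1` of `G` trivial on `N`,
and `t : ι → G` ANY transversal of `G / N`.  Then there are an IRREDUCIBLE framed
`s : H →ₜ* GL_m(A)`, a change of frame `Q ∈ GL_n(A)` and a relabelling `e : ι × Fin m ≃ Fin n` with
`Q r(x) Q⁻¹ = reindex e e (Ind(s)(x))` for every `x ∈ G`, `Ind(s)(x) = (ṡ(tᵢ⁻¹ x tⱼ))ᵢⱼ`
(`indMatrix`, flattened by `Matrix.comp`): `V = ⊕ᵢ r(tᵢ) V_{λ₀}` for an eigenvalue `λ₀` of `P`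
(`N = ker χ`, so the `χ(tᵢ)` are distinct), `s` is the frame of the `N`-representation on
`V_{λ₀}`, and `Q` is the change of basis to `B (i, a) = r(tᵢ) u_a`. [cite: Clifford1937, Thm. 1]
[cite: SerreLinearRepresentations1977, §8.1 Prop. 24, §3.3 Thm. 12 (proof)] -/
theorem FramedRep.exists_conj_eq_reindex_comp_indMatrix_of_conj_eq_twist [IsAlgClosed A]
    (r : FramedRep G A n) (hirr : r.IsIrreducible) (φ : H →ₜ* G) (hinj : Function.Injective φ)
    {p : ℕ} (hp : p.Prime) (hφ : φ.toMonoidHom.range.index = p) (χ : G →ₜ* Aˣ)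
    (hχ : ∀ h : H, χ (φ h) = 1) (hχ1 : χ ≠ 1) (P : GL (Fin n) A)
    (hP : FramedRep.conj P r = r.twist χ) {ι : Type*} [Fintype ι] [DecidableEq ι] (t : ι → G)
    (ht : Function.Bijective fun i => (t i : G ⧸ φ.toMonoidHom.range)) :
    ∃ (m : ℕ) (s : FramedRep H A m) (Q : GL (Fin n) A) (e : ι × Fin m ≃ Fin n),
      s.IsIrreducible ∧ ∀ x : G,
        ((FramedRep.conj Q r x : GL (Fin n) A) : Matrix (Fin n) (Fin n) A) =
          Matrix.reindex e e (Matrix.comp ι ι (Fin m) (Fin m) A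
            (indMatrix φ.toMonoidHom (FramedRep.toMatrixHom s) t x)) := by
  classical
  set ρ := r.toRepresentation with hρdef
  set N : Subgroup G := φ.toMonoidHom.range with hNdef
  have hinj' : Function.Injective φ.toMonoidHom := hinj
  have hn : 0 < n := hirr.rank_pos
  haveI : Nonempty (Fin n) := ⟨⟨0, hn⟩⟩
  -- the operator `T = P` and the relation `T (ρ g v) = χ g • ρ g (T v)`
  set T : Module.End A (Fin n → A) := Matrix.toLin' (P : Matrix (Fin n) (Fin n) A) with hTdef
  have hPr : ∀ g : G, (P : Matrix (Fin n) (Fin n) A) * ((r g : GL (Fin n) A) : Matrix _ _ A) =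
      (χ g : A) • (((r g : GL (Fin n) A) : Matrix (Fin n) (Fin n) A) * (P : Matrix _ _ A)) :=
    fun g => by
    have h1 := congrArg
      (fun σ : FramedRep G A n => ((σ g : GL (Fin n) A) : Matrix (Fin n) (Fin n) A)) hP
    simp only [FramedRep.conj_apply, FramedRep.coe_twist_apply, Units.val_mul] at h1
    calc (P : Matrix (Fin n) (Fin n) A) * ((r g : GL (Fin n) A) : Matrix _ _ A)
        = (P : Matrix (Fin n) (Fin n) A) * ((r g : GL (Fin n) A) : Matrix _ _ A) *
            ((P⁻¹ : GL (Fin n) A) : Matrix _ _ A) * (P : Matrix (Fin n) (Fin n) A) := by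
          rw [Units.inv_mul_cancel_right]
      _ = (χ g : A) • ((r g : GL (Fin n) A) : Matrix (Fin n) (Fin n) A) * (P : Matrix _ _ A) := by
          rw [h1]
      _ = (χ g : A) • (((r g : GL (Fin n) A) : Matrix (Fin n) (Fin n) A) * (P : Matrix _ _ A)) :=
          smul_mul_assoc _ _ _
  have hrel : ∀ (g : G) (v : Fin n → A), T (ρ g v) = (χ g : A) • ρ g (T v) := fun g v => by
    rw [hTdef, Matrix.toLin'_apply, Matrix.toLin'_apply, FramedRep.toRepresentation_apply_apply,
      FramedRep.toRepresentation_apply_apply, Matrix.mulVec_mulVec, hPr, Matrix.smul_mulVec,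
      Matrix.mulVec_mulVec]
  -- `ρ g` maps the `μ`-eigenspace of `T` into the `χ(g) μ`-eigenspace
  have hmapE : ∀ (g : G) (μ : A), ∀ v ∈ T.eigenspace μ, ρ g v ∈ T.eigenspace ((χ g : A) * μ) := by
    intro g μ v hv
    rw [Module.End.mem_eigenspace_iff] at hv ⊢
    rw [hrel, hv, map_smul, smul_smul]
  -- `N = ker χ`: `N ≤ ker χ`, both of index `p` (`χ ≠ 1`); hence `i ↦ χ (t i)` is injective
  have hNK : N ≤ χ.toMonoidHom.ker := by
    rintro _ ⟨h, rfl⟩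
    exact hχ h
  have hKN : χ.toMonoidHom.ker ≤ N := by
    obtain ⟨g₀, hg₀⟩ : ∃ g₀ : G, χ g₀ ≠ 1 := by
      by_contra! hall
      exact hχ1 (ContinuousMonoidHom.ext hall)
    have hKidx : χ.toMonoidHom.ker.index = p := by
      have hdvd : χ.toMonoidHom.ker.index ∣ p := hφ ▸ Subgroup.index_dvd_of_le hNK
      rcases (Nat.dvd_prime hp).mp hdvd with h1 | h1
      · exfalso
        rw [Subgroup.index_eq_one] at h1
        exact hg₀ (h1 ▸ Subgroup.mem_top g₀ : g₀ ∈ χ.toMonoidHom.ker)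
      · exact h1
    refine Subgroup.relIndex_eq_one.mp ?_
    have h1 := Subgroup.relIndex_mul_index hNK
    rw [hKidx, hφ] at h1
    exact (mul_eq_right₀ hp.ne_zero).mp h1
  have hχt : ∀ i j : ι, χ (t i) = χ (t j) → i = j := fun i j hij => by
    apply ht.1
    change (t i : G ⧸ N) = (t j : G ⧸ N)
    rw [QuotientGroup.eq]
    apply hKN
    rw [MonoidHom.mem_ker, map_mul, map_inv, inv_mul_eq_one]
    exact hij
  -- the index `i₁` of the trivial coset
  obtain ⟨i₁, hi₁⟩ := ht.2 ((1 : G) : G ⧸ N)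
  have hti₁ : t i₁ ∈ N := by
    have h1 : (t i₁)⁻¹ * 1 ∈ N := QuotientGroup.eq.mp hi₁
    rw [mul_one] at h1
    exact inv_mem_iff.mp h1
  have hχi₁ : χ (t i₁) = 1 := MonoidHom.mem_ker.mp (hNK hti₁)
  -- an eigenvalue `c₀ ≠ 0` of `T`, the `N`-stable eigenspace `U = V_{c₀}`
  obtain ⟨c₀, hc₀⟩ := Module.End.exists_eigenvalue T
  have hUb' : T.eigenspace c₀ ≠ ⊥ := Module.End.hasEigenvalue_iff.mp hc₀
  have hc₀0 : c₀ ≠ 0 := by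
    rintro rfl
    apply hUb'
    rw [Module.End.eigenspace_zero, eq_bot_iff]
    intro v hv
    rw [LinearMap.mem_ker, hTdef, Matrix.toLin'_apply] at hv
    rw [Submodule.mem_bot, ← Matrix.one_mulVec v, ← Units.inv_mul P, ← Matrix.mulVec_mulVec, hv,
      Matrix.mulVec_zero]
  let W : Subrepresentation (ρ.comp φ.toMonoidHom) :=
    ⟨T.eigenspace c₀, fun h v hv => by
      have h1 := hmapE (φ h) c₀ v hv
      rw [hχ h, Units.val_one, one_mul] at h1
      exact h1⟩
  set U : Submodule A (Fin n → A) := W.toSubmodule with hUdef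
  have hUT : U = T.eigenspace c₀ := rfl
  have hWb : W ≠ ⊥ := fun h => hUb' (congrArg Subrepresentation.toSubmodule h)
  have hHU : ∀ (h : H), ∀ v ∈ U, ρ (φ h) v ∈ U := fun h v hv => W.apply_mem_toSubmodule h hv
  -- the family `F i = ρ(t i) U ≤ E i = V_{χ(t i) c₀}`: independent, spanning
  set E : ι → Submodule A (Fin n → A) := fun i => T.eigenspace ((χ (t i) : A) * c₀) with hEdef
  set F : ι → Submodule A (Fin n → A) := fun i => U.map (ρ (t i)) with hFdef
  have hFE : ∀ i, F i ≤ E i := by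
    rintro i _ ⟨v, hv, rfl⟩
    exact hmapE (t i) c₀ v hv
  have hE : iSupIndep E := by
    have hμ : Function.Injective fun i : ι => ((χ (t i) : Aˣ) : A) * c₀ := fun i j hij =>
      hχt i j (Units.val_injective (mul_right_cancel₀ hc₀0 hij))
    exact T.eigenspaces_iSupIndep.comp hμ
  have hF : iSupIndep F := hE.mono hFE
  have hEi₁ : E i₁ = U := by
    change T.eigenspace ((χ (t i₁) : A) * c₀) = T.eigenspace c₀
    rw [hχi₁, Units.val_one, one_mul]
  have hFsup : ⨆ i, F i = ⊤ := by
    haveI : _root_.Representation.IsIrreducible ρ := hirr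
    let S : Subrepresentation ρ := ⟨⨆ i, F i, fun x v hv =>
      Representation.map_iSup_map_le_of_transversal ρ φ.toMonoidHom ht.2 hHU x v hv⟩
    rcases IsSimpleOrder.eq_bot_or_eq_top S with h | h
    · exfalso
      apply hUb'
      have h' : (⨆ i, F i) = ⊥ := congrArg Subrepresentation.toSubmodule h
      have h1 : F i₁ = ⊥ := le_bot_iff.mp ((le_iSup F i₁).trans h'.le)
      rw [← hUT]
      refine Submodule.map_injective_of_injective
        (Literature.RepresentationTheory.Semisimple.rep_apply_injective ρ (t i₁)) ?_
      rw [Submodule.map_bot]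
      exact h1
    · exact congrArg Subrepresentation.toSubmodule h
  have hint : DirectSum.IsInternal F :=
    DirectSum.isInternal_submodule_of_iSupIndep_of_iSup_eq_top hF hFsup
  -- the `H`-representation on `U`, continuous for the subspace (= module) topology, and its frame
  haveI : IsModuleTopology A U := TwistedSum.isModuleTopology_submodule_pi U
  let σU : ContinuousRep H A U := ⟨W.toRepresentation, by
    rw [Topology.IsInducing.subtypeVal.continuous_iff]
    change Continuous fun q : H × U =>
      ((r (φ q.1) : GL (Fin n) A) : Matrix (Fin n) (Fin n) A).mulVec (q.2 : Fin n → A)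
    exact ((Units.continuous_val.comp ((map_continuous r).comp
      ((map_continuous φ).comp continuous_fst))).matrix_mulVec
      (continuous_subtype_val.comp continuous_snd))⟩
  set m := Module.finrank A U with hmdef
  let bU : Module.Basis (Fin m) A U := Module.finBasis A U
  let s : FramedRep H A m := σU.frame bU
  have hs_coe : ∀ h : H, ((s h : GL (Fin m) A) : Matrix (Fin m) (Fin m) A) =
      LinearMap.toMatrix bU bU (W.toRepresentation h) := fun h => rfl
  -- the adapted basis `B (i, a) = ρ (t i) (bU a)` of `V = ⊕ᵢ F i`, relabelled by `e`
  let eU : ∀ i : ι, U ≃ₗ[A] F i := fun i =>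
    Submodule.equivMapOfInjective (ρ (t i))
      (Literature.RepresentationTheory.Semisimple.rep_apply_injective ρ (t i)) U
  let B : Module.Basis (ι × Fin m) A (Fin n → A) :=
    (hint.collectedBasis fun i => bU.map (eU i)).reindex (Equiv.sigmaEquivProd ι (Fin m))
  have hB : ∀ (i : ι) (a : Fin m), B (i, a) = ρ (t i) (bU a : Fin n → A) := by
    intro i a
    simp only [B, eU, Module.Basis.reindex_apply, hint.collectedBasis_coe, Module.Basis.map_apply]
    exact Submodule.coe_equivMapOfInjective_apply _ _ _ _
  let e : ι × Fin m ≃ Fin n := B.indexEquiv (Pi.basisFun A (Fin n))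
  obtain ⟨Q, hQ⟩ := Matrix.exists_units_conj_eq_reindex_toMatrix B e
  refine ⟨m, s, Q, e, ?_, fun x => ?_⟩
  · -- `s` is irreducible: the transversal `t' = t[i₁ ↦ 1]` has `t' i₁ = 1`
    set t' : ι → G := Function.update t i₁ 1 with ht'def
    have htt' : (fun i => (t' i : G ⧸ N)) = fun i => (t i : G ⧸ N) := by
      funext i
      by_cases hi : i = i₁
      · subst hi
        rw [ht'def, Function.update_self]
        exact hi₁.symm
      · rw [ht'def, Function.update_of_ne hi]
    have ht' : Function.Surjective fun i => (t' i : G ⧸ N) := htt' ▸ ht.2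
    have hWE : ∀ i, U.map (ρ (t' i)) ≤ E i := fun i => by
      by_cases hi : i = i₁
      · subst hi
        rw [ht'def, Function.update_self, map_one, Module.End.one_eq_id, Submodule.map_id, hEi₁]
      · rw [ht'def, Function.update_of_ne hi]
        exact hFE i
    haveI : W.toRepresentation.IsIrreducible :=
      Representation.isIrreducible_toRepresentation_of_iSupIndep ρ hirr φ.toMonoidHom ht' W hWb
        E hE hWE (Function.update_self i₁ 1 t) hEi₁.le
    exact Literature.RepresentationTheory.Semisimple.Representation.isIrreducible_of_equiv
      (σU.frameEquiv bU).toRepEquiv.symm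
  · -- the conjugacy: `Q r(x) Q⁻¹ = reindex e e [ρ x]_B = reindex e e (Ind(s)(x))`
    have hcol : ∀ (h : H) (b : Fin m),
        ρ (φ.toMonoidHom h) (bU b : Fin n → A) =
          ∑ c, (FramedRep.toMatrixHom s h) c b • (bU c : Fin n → A) := by
      intro h b
      rw [FramedRep.toMatrixHom_apply, hs_coe]
      have h1 : W.toRepresentation h (bU b) =
          ∑ c, (LinearMap.toMatrix bU bU (W.toRepresentation h)) c b • bU c := by
        conv_lhs => rw [← Matrix.toLin_toMatrix bU bU (W.toRepresentation h)]
        rw [Matrix.toLin_self]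
      have h2 : ρ (φ h) (bU b : Fin n → A) = ((W.toRepresentation h (bU b) : U) : Fin n → A) :=
        rfl
      change ρ (φ h) (bU b : Fin n → A) = _
      rw [h2, h1]
      simp
    have hρx : LinearMap.toMatrix' (ρ x) = ((r x : GL (Fin n) A) : Matrix (Fin n) (Fin n) A) := by
      have h1 : ρ x = Matrix.toLin' ((r x : GL (Fin n) A) : Matrix (Fin n) (Fin n) A) :=
        LinearMap.ext fun v => (Matrix.toLin'_apply _ v).symm
      rw [h1, LinearMap.toMatrix'_toLin']
    rw [← Representation.toMatrix_eq_comp_indMatrix ρ hinj' ht (fun a => (bU a : Fin n → A))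
        (FramedRep.toMatrixHom s) hcol B hB x, ← hQ (ρ x), hρx, FramedRep.conj_apply,
      Units.val_mul, Units.val_mul]

end Framed

/-! ### Galois representations: Galois layers of prime degree -/

section Galois

open Field

/-- **Clifford's theorem for a Galois extension of number fields of prime degree (explicit
conjugacy to the induced representation).**  Let `L/K` be a Galois extension of number fields of
prime degree `p = [L : K]`, `A` an algebraically closed topological field of characteristic zero,
and `r : Γ_K → GL_n(A)` an IRREDUCIBLE framed Galois representation whose restriction `r|_{Γ_L}`
(`restrictField`) is NOT irreducible.  Then there are an irreducible framed `s : Γ_L → GL_m(A)`, a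
change of frame `Q ∈ GL_n(A)` and a relabelling `e : Fin (p m) ≃ Fin n` with
`Q r(x) Q⁻¹ = reindex e e (Ind_{Γ_L}^{Γ_K}(s)(x))` for every `x ∈ Γ_K` (`FramedGaloisRep.induce`),
i.e. `r ≅ Ind_{Γ_L}^{Γ_K} s` as framed representations.  Proof: `Gal(L/K)` is cyclic of order `p`,
so `r` is a non-trivial twist of itself by a character of `Gal(L/K)`
(`FramedGaloisRep.exists_twist_conj_of_not_isIrreducible_restrictField`), and
`FramedRep.exists_conj_eq_reindex_comp_indMatrix_of_conj_eq_twist` applies to the transversal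
`absGaloisCosetRep K L rfl` used by `induce` (`[Γ_K : res Γ_L] = [L : K]`,
`nat_card_quotient_range_absGaloisRestrict`); `induce` is that block matrix relabelled by
`finProdFinEquiv`. [cite: Clifford1937, Thm. 1]
[cite: SerreLinearRepresentations1977, §8.1 Prop. 24, §7.3 Prop. 22] -/
theorem exists_conj_eq_reindex_induce_of_not_isIrreducible_restrictField_of_prime :
    ∀ (K L : Type) [Field K] [NumberField K] [Field L] [NumberField L] [Algebra K L]
      [IsGalois K L], (Module.finrank K L).Prime →
      ∀ {A : Type} [Field A] [TopologicalSpace A] [IsTopologicalRing A] [IsAlgClosed A]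
        [CharZero A] {n : ℕ}
        (r : Literature.NumberTheory.GaloisRepresentations.FramedGaloisRep K A n),
        Literature.NumberTheory.GaloisRepresentations.FramedRep.IsIrreducible r →
        ¬ Literature.NumberTheory.GaloisRepresentations.FramedRep.IsIrreducible
            (r.restrictField L) →
        ∃ (m : ℕ) (s : Literature.NumberTheory.GaloisRepresentations.FramedGaloisRep L A m)
          (Q : GL (Fin n) A) (e : Fin (Module.finrank K L * m) ≃ Fin n),
          Literature.NumberTheory.GaloisRepresentations.FramedRep.IsIrreducible s ∧
          ∀ x : Field.absoluteGaloisGroup K,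
            ((Literature.NumberTheory.GaloisRepresentations.FramedRep.conj Q r x :
                GL (Fin n) A) : Matrix (Fin n) (Fin n) A) =
              Matrix.reindex e e
                ((s.induce K (rfl : Module.finrank K L = Module.finrank K L) x :
                  GL (Fin (Module.finrank K L * m)) A) :
                    Matrix (Fin (Module.finrank K L * m)) (Fin (Module.finrank K L * m)) A) := by
  intro K L _ _ _ _ _ _ hp A _ _ _ _ _ n r hirr hred
  haveI : Fact (Module.finrank K L).Prime := ⟨hp⟩
  haveI : IsCyclic (L ≃ₐ[K] L) :=
    isCyclic_of_prime_card (p := Module.finrank K L) (IsGalois.card_aut_eq_finrank K L)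
  obtain ⟨χ, P, hχ, hχ1, hP⟩ :=
    FramedGaloisRep.exists_twist_conj_of_not_isIrreducible_restrictField (M := L) r hirr hred
  have hidx : (absGaloisRestrict K L).toMonoidHom.range.index = Module.finrank K L :=
    nat_card_quotient_range_absGaloisRestrict K L
  obtain ⟨m, s, Q, e, hs, hconj⟩ :=
    FramedRep.exists_conj_eq_reindex_comp_indMatrix_of_conj_eq_twist r hirr
      (absGaloisRestrict K L) (absGaloisRestrict_injective K L) hp hidx χ hχ hχ1 P hP
      (absGaloisCosetRep K L rfl) (absGaloisCosetRep_bijective K L rfl)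
  refine ⟨m, s, Q, finProdFinEquiv.symm.trans e, hs, fun x => ?_⟩
  rw [hconj x, FramedGaloisRep.induce_def, FramedRep.induce_apply_coe,
    FramedRep.indFlatHom_apply_eq_reindex]
  ext i j
  simp only [Matrix.reindex_apply, Matrix.submatrix_apply, Equiv.symm_trans_apply,
    Equiv.symm_symm, Equiv.symm_apply_apply]

end Galois

end Literature.NumberTheory.GaloisRepresentations

end
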